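import Literature.NumberTheory.EllipticCurves.BinaryQuarticRealTypesProofs
import Mathlib.MeasureTheory.Measure.Lebesgue.Integral
import Mathlib.MeasureTheory.Integral.IntervalIntegral.Basic
import Mathlib.Analysis.SpecialFunctions.Integrals.Basic
import HarnessLib

/-!
# Bhargava–Shankar §2.4: the regions `R⁺(X)`, `R⁻(X)` of invariants of bounded height, their areas
# `8/5·X^{5/6}`, `32/5·X^{5/6}` (eqs. (19)–(20)), and the reduction of Thm 2.1 to eqs. (17)–(18)

Topic `Literature/NumberTheory/EllipticCurves`; companion of `BinaryQuarticForms.lean` (Thm 2.1 =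
`Literature.NumberTheory.EllipticCurves.bhargavaShankar_classCount`) and
`BinaryQuarticRealTypesProofs.lean` (`N(V_ℤ^{(2)}; X) = 2·N(V_ℤ^{(2+)}; X)`).

Source: M. Bhargava, A. Shankar, *Binary quartic forms having bounded invariants, and the
boundedness of the average rank of elliptic curves*, Ann. of Math. (2) 181 (2015) 191–242,
doi:10.4007/annals.2015.181.1.3; equation numbers are those of the held arXiv text
`arXiv:1006.1002v2`, §2.3–2.4 (as in `BinaryQuarticForms.lean`).

## The printed end of the proof of Thm 2.1 (§2.3–2.4 of the held text)

For `i ∈ {0, 1, 2+, 2−}` the averaging method (Gauss's fundamental domain `𝓕`, the fundamental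
sets `L_V^{(i)}`, Davenport's lemma Prop. 2.5, Prop. 2.6, Lemmas 2.3–2.4) gives
`N(V_ℤ^{(i)}; X) = Vol(𝓡_X(L_V^{(i)}))/n_i + O(X^{3/4+ε})` **(17)**, `n_0 = n_{2±} = 4`, `n_1 = 2`
(Lemma 2.2); the Jacobian identity Prop. 2.7 gives
`Vol(𝓡_X(L_V^{(i)})) = (2/27)·ζ(2)·∫_{R_V^{(i)}(X)} dI dJ` **(18)**, where `ζ(2)` is the volume of
`SL₂(ℤ)\SL₂(ℝ)` and `R_V^{(i)}(X)` is identified ("canonical one-to-one correspondence", measure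
`dI dJ`) with `R⁺(X) = {(I,J) ∈ ℝ² : H(I,J) < X, 4I³ − J² > 0}` for `i = 0, 2±` and with
`R⁻(X) = {(I,J) : H(I,J) < X, 4I³ − J² < 0}` for `i = 1` (`H(I,J) = max(|I|³, J²/4)`); then
`∫_{R⁺(X)} dI dJ = ∫₀^{X^{1/3}} 4I^{3/2} dI = (8/5)X^{5/6}` **(19)**,
`∫_{R⁻(X)} dI dJ = 8X^{5/6} − (8/5)X^{5/6} = (32/5)X^{5/6}` **(20)**, so
`Vol(𝓡_X(L_V^{(i)})) = (16/135)ζ(2)X^{5/6}` (`i = 0, 2±`), `(64/135)ζ(2)X^{5/6}` (`i = 1`) **(22)**,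
"and as `n_0 = n_{2+} = n_{2−} = 4` and `n_1 = 2`, equations (17) and (22) now immediately imply
Theorem 2.1" (with `N(V_ℤ^{(2)}; X) = N(V_ℤ^{(2+)}; X) + N(V_ℤ^{(2−)}; X)`).

## Contents (everything here is PROVED; no named facts)

* `realHeightIJ I J = max(|I|³, J²/4)` on `ℝ × ℝ` (agrees with `BinaryQuartic.heightIJ` on `ℤ × ℤ`,
  `realHeightIJ_intCast`); `posDiscRegion X = R⁺(X)`, `negDiscRegion X = R⁻(X)`.
* **eq. (19)** `volume_posDiscRegion : volume R⁺(X) = (8/5)·X^{5/6}` and **eq. (20)**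
  `volume_negDiscRegion : volume R⁻(X) = (32/5)·X^{5/6}` (`0 < X`), via
  `R⁺(X) = {0 < I < X^{1/3}, |J| < 2I^{3/2}}` (`posDiscRegion_eq_regionBetween`), the box
  `{H < X} = (−X^{1/3}, X^{1/3}) × (−2√X, 2√X)` of area `8X^{5/6}` (`volume_heightBox`), and the
  null curve `4I³ = J²` (`volume_zeroDiscCurve`).
* `bhargavaShankar_classCount_of_eq17_eq18`: **Thm 2.1 follows from the three instances
  `i = 0, 1, 2+` of (17)∘(18)**, i.e. from
  `N(V_ℤ^{(i)}; X) = (2/27)·(π²/6)·Vol(R^{±}(X))/n_i + O_ε(X^{3/4+ε})`, by (19), (20) and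
  `N(V_ℤ^{(2)}; X) = 2N(V_ℤ^{(2+)}; X)` (`gl2zClassCount_noRealRoots`). The three hypotheses are the
  geometry-of-numbers content of the paper (reduction theory + Davenport's lemma + Prop. 2.7) and are
  NOT vendored as named facts here; this theorem only certifies the bookkeeping
  `(2/27)·(8/5)/4 = 4/135`, `(2/27)·(32/5)/2 = 32/135`, `2·(2/27)·(8/5)/4 = 8/135`.

## References

* [BhargavaShankarAnnals2015] §2.3 eq. (17), §2.4 eqs. (18)–(22) (arXiv:1006.1002v2 numbering).
-/

noncomputable section

open scoped Classical
open MeasureTheory Set Real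

namespace Literature.NumberTheory.EllipticCurves

namespace BinaryQuartic

/-! ## The height on `ℝ × ℝ` and the regions `R⁺(X)`, `R⁻(X)` -/

/-- The height `H(I,J) = max(|I|³, J²/4)` of a pair of *real* invariants (Bhargava–Shankar 2015,
§2 eq. (3): `H(f) := H(I,J) := max{|I|³, J²/4}` on `V_ℝ`). [cite: BhargavaShankarAnnals2015, §2 eq. (3)] -/
def realHeightIJ (I J : ℝ) : ℝ :=
  max (|I| ^ 3) (J ^ 2 / 4)

/-- On integral invariants `realHeightIJ` is the tree's `heightIJ`. [folklore] -/
@[simp] theorem realHeightIJ_intCast (I J : ℤ) : realHeightIJ I J = heightIJ I J := rfl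

/-- `R⁺(X) = R_V^{(0)}(X) = R_V^{(2±)}(X)`: pairs `(I,J) ∈ ℝ²` of height `< X` and positive
discriminant `4I³ − J² > 0` (Bhargava–Shankar 2015, §2.4: `R_V^{(i)}` "is in canonical one-to-one
correspondence with `{(I,J) : I³ − J²/4 > 0}` if `i = 0, 2+, 2−`", `R_V^{(i)}(X)` its part of height
`< X`; `= R_X^+` of Prop. 2.10). [cite: BhargavaShankarAnnals2015, §2.4 (R_V^{(i)}(X)) and Prop. 2.10 (R_X^+)] -/
def posDiscRegion (X : ℝ) : Set (ℝ × ℝ) :=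
  {p | realHeightIJ p.1 p.2 < X ∧ 0 < 4 * p.1 ^ 3 - p.2 ^ 2}

/-- `R⁻(X) = R_V^{(1)}(X)`: pairs `(I,J) ∈ ℝ²` of height `< X` and negative discriminant
`4I³ − J² < 0` (Bhargava–Shankar 2015, §2.4; `= R_X^−` of Prop. 2.10).
[cite: BhargavaShankarAnnals2015, §2.4 (R_V^{(1)}(X)) and Prop. 2.10 (R_X^-)] -/
def negDiscRegion (X : ℝ) : Set (ℝ × ℝ) :=
  {p | realHeightIJ p.1 p.2 < X ∧ 4 * p.1 ^ 3 - p.2 ^ 2 < 0}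

/-- The box `{(I,J) : H(I,J) < X}`. [folklore] -/
def heightBox (X : ℝ) : Set (ℝ × ℝ) :=
  {p | realHeightIJ p.1 p.2 < X}

/-- The curve `{H < X, 4I³ = J²}` separating `R⁺(X)` and `R⁻(X)`. [folklore] -/
def zeroDiscCurve (X : ℝ) : Set (ℝ × ℝ) :=
  {p | realHeightIJ p.1 p.2 < X ∧ 4 * p.1 ^ 3 - p.2 ^ 2 = 0}

/-! ## Elementary real-analysis lemmas -/

/-- `(I,J) ↦ H(I,J)` is continuous. [folklore] -/
theorem continuous_realHeightIJ : Continuous fun p : ℝ × ℝ ↦ realHeightIJ p.1 p.2 := by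
  unfold realHeightIJ
  fun_prop

/-- `(I,J) ↦ 4I³ − J²` is continuous. [folklore] -/
theorem continuous_discQuantity : Continuous fun p : ℝ × ℝ ↦ 4 * p.1 ^ 3 - p.2 ^ 2 := by
  fun_prop

/-- `|I|³ < X ↔ −X^{1/3} < I < X^{1/3}` (`X > 0`). [folklore] -/
theorem abs_pow_three_lt_iff {X : ℝ} (hX : 0 < X) (I : ℝ) :
    |I| ^ 3 < X ↔ I ∈ Ioo (-X ^ (1 / 3 : ℝ)) (X ^ (1 / 3 : ℝ)) := by
  have hA : 0 ≤ X ^ (1 / 3 : ℝ) := rpow_nonneg hX.le _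
  have hA3 : (X ^ (1 / 3 : ℝ)) ^ 3 = X := by
    rw [← rpow_natCast, ← rpow_mul hX.le]; norm_num
  rw [mem_Ioo, ← abs_lt, ← pow_lt_pow_iff_left₀ (abs_nonneg I) hA three_ne_zero, hA3]

/-- `J²/4 < X ↔ −2√X < J < 2√X` (`X > 0`). [folklore] -/
theorem sq_div_four_lt_iff {X : ℝ} (hX : 0 < X) (J : ℝ) :
    J ^ 2 / 4 < X ↔ J ∈ Ioo (-(2 * √X)) (2 * √X) := by
  have h2 : 0 ≤ 2 * √X := by positivity
  have hsq : (2 * √X) ^ 2 = 4 * X := by rw [mul_pow, sq_sqrt hX.le]; norm_num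
  rw [mem_Ioo, ← abs_lt, show (2 * √X) = |2 * √X| from (abs_of_nonneg h2).symm, ← sq_lt_sq, hsq]
  constructor <;> intro h <;> linarith

/-- `(2·I^{3/2})² = 4I³` for `I ≥ 0`. [folklore] -/
theorem sq_two_mul_rpow_three_halves {I : ℝ} (hI : 0 ≤ I) :
    (2 * I ^ (3 / 2 : ℝ)) ^ 2 = 4 * I ^ 3 := by
  rw [mul_pow, ← rpow_natCast (I ^ (3 / 2 : ℝ)) 2, ← rpow_mul hI]
  norm_num

/-- For `I > 0`: `J² < 4I³ ↔ |J| < 2I^{3/2}`. [folklore] -/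
theorem sq_lt_four_mul_pow_three_iff {I : ℝ} (hI : 0 ≤ I) (J : ℝ) :
    J ^ 2 < 4 * I ^ 3 ↔ J ∈ Ioo (-(2 * I ^ (3 / 2 : ℝ))) (2 * I ^ (3 / 2 : ℝ)) := by
  have h2 : 0 ≤ 2 * I ^ (3 / 2 : ℝ) := by positivity
  rw [mem_Ioo, ← abs_lt, show (2 * I ^ (3 / 2 : ℝ)) = |2 * I ^ (3 / 2 : ℝ)| from
    (abs_of_nonneg h2).symm, ← sq_lt_sq, sq_two_mul_rpow_three_halves hI]

/-! ## `R⁺(X)` as the region between `∓2I^{3/2}` over `(0, X^{1/3})`; its area (eq. (19)) -/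

/-- `R⁺(X) = {(I,J) : 0 < I < X^{1/3}, −2I^{3/2} < J < 2I^{3/2}}` (`X > 0`): for `4I³ > J² ≥ 0` one
has `I > 0`, `H(I,J) = I³`. [cite: BhargavaShankarAnnals2015, §2.4 eq. (19) (limits of integration)] -/
theorem posDiscRegion_eq_regionBetween {X : ℝ} (hX : 0 < X) :
    posDiscRegion X = regionBetween (fun I ↦ -(2 * I ^ (3 / 2 : ℝ))) (fun I ↦ 2 * I ^ (3 / 2 : ℝ))
      (Ioo 0 (X ^ (1 / 3 : ℝ))) := by
  ext ⟨I, J⟩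
  simp only [posDiscRegion, realHeightIJ, regionBetween, mem_setOf_eq, max_lt_iff, sub_pos]
  constructor
  · rintro ⟨⟨hI3, hJ⟩, hdisc⟩
    have hIpos : 0 < I := by
      have : 0 < I ^ 3 := by nlinarith [sq_nonneg J]
      exact (Odd.pow_pos_iff (by decide : Odd 3)).mp this
    refine ⟨⟨hIpos, ?_⟩, (sq_lt_four_mul_pow_three_iff hIpos.le J).mp hdisc⟩
    have := (abs_pow_three_lt_iff hX I).mp hI3
    exact this.2
  · rintro ⟨⟨hIpos, hIA⟩, hJ⟩
    have hdisc : J ^ 2 < 4 * I ^ 3 := (sq_lt_four_mul_pow_three_iff hIpos.le J).mpr hJ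
    have hI3 : |I| ^ 3 < X := by
      rw [abs_pow_three_lt_iff hX]
      exact ⟨by linarith [rpow_nonneg hX.le (1 / 3 : ℝ)], hIA⟩
    have hI3' : I ^ 3 < X := by rwa [abs_of_pos hIpos] at hI3
    exact ⟨⟨hI3, by linarith⟩, hdisc⟩

/-- `I ↦ 2I^{3/2}` is continuous. [folklore] -/
theorem continuous_two_mul_rpow_three_halves : Continuous fun I : ℝ ↦ 2 * I ^ (3 / 2 : ℝ) :=
  continuous_const.mul (continuous_id.rpow_const fun _ ↦ Or.inr (by norm_num))

/-- `∫₀^{X^{1/3}} 4 I^{3/2} dI = (8/5) X^{5/6}`. [cite: BhargavaShankarAnnals2015, §2.4 eq. (19)] -/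
theorem integral_four_mul_rpow_three_halves {X : ℝ} (hX : 0 < X) :
    ∫ I in (0 : ℝ)..X ^ (1 / 3 : ℝ), 4 * I ^ (3 / 2 : ℝ) = 8 / 5 * X ^ (5 / 6 : ℝ) := by
  rw [intervalIntegral.integral_const_mul, integral_rpow (Or.inl (by norm_num))]
  have h1 : (X ^ (1 / 3 : ℝ)) ^ ((3 / 2 : ℝ) + 1) = X ^ (5 / 6 : ℝ) := by
    rw [← rpow_mul hX.le]; norm_num
  have h2 : (0 : ℝ) ^ ((3 / 2 : ℝ) + 1) = 0 := zero_rpow (by norm_num)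
  rw [h1, h2]
  ring

/-- **Eq. (19)**: `Vol(R⁺(X)) = ∫₀^{X^{1/3}} 4I^{3/2} dI = (8/5)·X^{5/6}`.
[cite: BhargavaShankarAnnals2015, §2.4 eq. (19)] -/
theorem volume_posDiscRegion {X : ℝ} (hX : 0 < X) :
    volume (posDiscRegion X) = ENNReal.ofReal (8 / 5 * X ^ (5 / 6 : ℝ)) := by
  have hA : 0 ≤ X ^ (1 / 3 : ℝ) := rpow_nonneg hX.le _
  have hcont := continuous_two_mul_rpow_three_halves
  have hgi : IntegrableOn (fun I : ℝ ↦ 2 * I ^ (3 / 2 : ℝ)) (Ioo 0 (X ^ (1 / 3 : ℝ))) volume :=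
    (hcont.integrableOn_Icc (a := 0) (b := X ^ (1 / 3 : ℝ))).mono_set Ioo_subset_Icc_self
  have hfi : IntegrableOn (fun I : ℝ ↦ -(2 * I ^ (3 / 2 : ℝ))) (Ioo 0 (X ^ (1 / 3 : ℝ))) volume :=
    hgi.neg
  rw [posDiscRegion_eq_regionBetween hX, Measure.volume_eq_prod,
    volume_regionBetween_eq_integral hfi hgi measurableSet_Ioo
      (fun I hI ↦ by
        have : 0 ≤ 2 * I ^ (3 / 2 : ℝ) := mul_nonneg zero_le_two (rpow_nonneg hI.1.le _)
        linarith)]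
  congr 1
  have hsub : ((fun I : ℝ ↦ 2 * I ^ (3 / 2 : ℝ)) - fun I : ℝ ↦ -(2 * I ^ (3 / 2 : ℝ))) =
      fun I : ℝ ↦ 4 * I ^ (3 / 2 : ℝ) := by
    funext I; simp only [Pi.sub_apply]; ring
  rw [hsub, ← integral_Ioc_eq_integral_Ioo, ← intervalIntegral.integral_of_le hA,
    integral_four_mul_rpow_three_halves hX]

/-! ## The box `{H < X}`, the null curve `4I³ = J²`, and the area of `R⁻(X)` (eq. (20)) -/

/-- `{H(I,J) < X} = (−X^{1/3}, X^{1/3}) × (−2√X, 2√X)`. [cite: BhargavaShankarAnnals2015, Prop. 2.10 (proof: |i| < X^{1/3}, |j| < 2X^{1/2})] -/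
theorem heightBox_eq_prod {X : ℝ} (hX : 0 < X) :
    heightBox X = Ioo (-X ^ (1 / 3 : ℝ)) (X ^ (1 / 3 : ℝ)) ×ˢ Ioo (-(2 * √X)) (2 * √X) := by
  ext ⟨I, J⟩
  simp only [heightBox, realHeightIJ, mem_setOf_eq, max_lt_iff, mem_prod,
    abs_pow_three_lt_iff hX, sq_div_four_lt_iff hX]

/-- `Vol{H < X} = 2X^{1/3} · 4X^{1/2} = 8X^{5/6}`. [cite: BhargavaShankarAnnals2015, §2.4 eq. (20) (first term)] -/
theorem volume_heightBox {X : ℝ} (hX : 0 < X) :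
    volume (heightBox X) = ENNReal.ofReal (8 * X ^ (5 / 6 : ℝ)) := by
  have hA : 0 ≤ X ^ (1 / 3 : ℝ) := rpow_nonneg hX.le _
  have hB : 0 ≤ √X := sqrt_nonneg X
  rw [heightBox_eq_prod hX, Measure.volume_eq_prod, Measure.prod_prod, volume_Ioo, volume_Ioo,
    ← ENNReal.ofReal_mul (by linarith)]
  congr 1
  have : X ^ (1 / 3 : ℝ) * √X = X ^ (5 / 6 : ℝ) := by
    rw [sqrt_eq_rpow, ← rpow_add hX]; norm_num
  linear_combination (8 : ℝ) * this

/-- `R⁺(X)` is measurable. [folklore] -/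
theorem measurableSet_posDiscRegion (X : ℝ) : MeasurableSet (posDiscRegion X) :=
  (measurableSet_lt continuous_realHeightIJ.measurable measurable_const).inter
    (measurableSet_lt measurable_const continuous_discQuantity.measurable)

/-- `R⁻(X)` is measurable. [folklore] -/
theorem measurableSet_negDiscRegion (X : ℝ) : MeasurableSet (negDiscRegion X) :=
  (measurableSet_lt continuous_realHeightIJ.measurable measurable_const).inter
    (measurableSet_lt continuous_discQuantity.measurable measurable_const)

/-- The curve `{H < X, 4I³ = J²}` is measurable. [folklore] -/
theorem measurableSet_zeroDiscCurve (X : ℝ) : MeasurableSet (zeroDiscCurve X) :=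
  (measurableSet_lt continuous_realHeightIJ.measurable measurable_const).inter
    (measurableSet_eq_fun continuous_discQuantity.measurable measurable_const)

/-- The curve `{4I³ = J²}` is Lebesgue-null (it lies on the two graphs `J = ±2I^{3/2}`).
[folklore] -/
theorem volume_zeroDiscCurve (X : ℝ) : volume (zeroDiscCurve X) = 0 := by
  set g : ℝ → ℝ := fun I ↦ 2 * I ^ (3 / 2 : ℝ) with hg
  have hgm : Measurable g := continuous_two_mul_rpow_three_halves.measurable
  have hsub : zeroDiscCurve X ⊆ {p : ℝ × ℝ | p.2 = g p.1} ∪ {p : ℝ × ℝ | p.2 = (-g) p.1} := by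
    rintro ⟨I, J⟩ ⟨-, h⟩
    have hI : 0 ≤ I := by
      by_contra hI
      have : I ^ 3 < 0 := Odd.pow_neg (by decide : Odd 3) (lt_of_not_ge hI)
      nlinarith [sq_nonneg J]
    have hsq : J ^ 2 = (2 * I ^ (3 / 2 : ℝ)) ^ 2 := by
      rw [sq_two_mul_rpow_three_halves hI]; linarith
    rcases sq_eq_sq_iff_eq_or_eq_neg.mp hsq with h | h
    · left; simpa [hg] using h
    · right; simp only [mem_setOf_eq, Pi.neg_apply, hg]; linarith
  have hgraph : ∀ f : ℝ → ℝ, Measurable f → volume {p : ℝ × ℝ | p.2 = f p.1} = 0 := by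
    intro f hf
    rw [Measure.volume_eq_prod, Measure.prod_apply (measurableSet_graph hf)]
    simp only [preimage_setOf_eq]
    simp
  apply measure_mono_null hsub
  exact measure_union_null (hgraph g hgm) (hgraph (-g) hgm.neg)

/-- **Eq. (20)**: `Vol(R⁻(X)) = Vol{H < X} − Vol(R⁺(X)) = 8X^{5/6} − (8/5)X^{5/6} = (32/5)·X^{5/6}`.
[cite: BhargavaShankarAnnals2015, §2.4 eq. (20)] -/
theorem volume_negDiscRegion {X : ℝ} (hX : 0 < X) :
    volume (negDiscRegion X) = ENNReal.ofReal (32 / 5 * X ^ (5 / 6 : ℝ)) := by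
  -- the box is the disjoint union `R⁻ ∪ R⁺ ∪ Z`
  have hdecomp : heightBox X = (negDiscRegion X ∪ posDiscRegion X) ∪ zeroDiscCurve X := by
    ext p
    simp only [heightBox, negDiscRegion, posDiscRegion, zeroDiscCurve, mem_setOf_eq, mem_union]
    constructor
    · intro h
      rcases lt_trichotomy (4 * p.1 ^ 3 - p.2 ^ 2) 0 with h' | h' | h'
      · exact Or.inl (Or.inl ⟨h, h'⟩)
      · exact Or.inr ⟨h, h'⟩
      · exact Or.inl (Or.inr ⟨h, h'⟩)
    · rintro ((⟨h, -⟩ | ⟨h, -⟩) | ⟨h, -⟩) <;> exact h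
  have hdisj₁ : Disjoint (negDiscRegion X) (posDiscRegion X) := by
    rw [disjoint_left]
    rintro p ⟨-, h1⟩ ⟨-, h2⟩
    linarith
  have hdisj₂ : Disjoint (negDiscRegion X ∪ posDiscRegion X) (zeroDiscCurve X) := by
    rw [disjoint_left]
    rintro p (⟨-, h1⟩ | ⟨-, h1⟩) ⟨-, h2⟩ <;> linarith
  have hvol : volume (heightBox X) =
      volume (negDiscRegion X) + volume (posDiscRegion X) + volume (zeroDiscCurve X) := by
    rw [hdecomp, measure_union hdisj₂ (measurableSet_zeroDiscCurve X),
      measure_union hdisj₁ (measurableSet_posDiscRegion X)]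
  rw [volume_zeroDiscCurve, add_zero, volume_heightBox hX, volume_posDiscRegion hX] at hvol
  have hfin : ENNReal.ofReal (8 / 5 * X ^ (5 / 6 : ℝ)) ≠ ⊤ := ENNReal.ofReal_ne_top
  rw [ENNReal.eq_sub_of_add_eq hfin hvol.symm, ← ENNReal.ofReal_sub _ (by positivity)]
  congr 1
  ring

/-- The areas as real numbers: `(Vol R⁺(X)).toReal = (8/5)X^{5/6}`. [cite: BhargavaShankarAnnals2015, §2.4 eq. (19)] -/
theorem volume_posDiscRegion_toReal {X : ℝ} (hX : 0 < X) :
    (volume (posDiscRegion X)).toReal = 8 / 5 * X ^ (5 / 6 : ℝ) := by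
  rw [volume_posDiscRegion hX, ENNReal.toReal_ofReal (by positivity)]

/-- The areas as real numbers: `(Vol R⁻(X)).toReal = (32/5)X^{5/6}`. [cite: BhargavaShankarAnnals2015, §2.4 eq. (20)] -/
theorem volume_negDiscRegion_toReal {X : ℝ} (hX : 0 < X) :
    (volume (negDiscRegion X)).toReal = 32 / 5 * X ^ (5 / 6 : ℝ) := by
  rw [volume_negDiscRegion hX, ENNReal.toReal_ofReal (by positivity)]

end BinaryQuartic

/-! ## Thm 2.1 from the three instances `i = 0, 1, 2+` of (17)∘(18) -/

open BinaryQuartic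

/-- **Reduction of Thm 2.1 to eqs. (17)–(18)** (Bhargava–Shankar 2015, end of §2.4: "as
`n_0 = n_{2+} = n_{2−} = 4` and `n_1 = 2`, equations (17) and (22) now immediately imply
Theorem 2.1"). If for `i = 0, 1, 2+`
`N(V_ℤ^{(i)}; X) = (2/27)·(π²/6)·Vol(R_V^{(i)}(X))/n_i + O_ε(X^{3/4+ε})` — the content of (17)
(averaging over Gauss's fundamental domain, Davenport's lemma) composed with (18) (the Jacobian
identity Prop. 2.7 and `Vol(SL₂(ℤ)\SL₂(ℝ)) = ζ(2) = π²/6`), with `R_V^{(0)}(X) = R_V^{(2+)}(X) = R⁺(X)`,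
`R_V^{(1)}(X) = R⁻(X)` — then `bhargavaShankar_classCount` (Thm 2.1 (a)–(c)) holds, by the areas
(19)–(20) and `N(V_ℤ^{(2)}; X) = 2N(V_ℤ^{(2+)}; X)`. The hypotheses are stated, not assumed as facts of
the tree. [cite: BhargavaShankarAnnals2015, §2.4 (eqs. (17)–(22) ⇒ Thm 2.1)] -/
theorem bhargavaShankar_classCount_of_eq17_eq18
    (h0 : ∀ ε : ℝ, 0 < ε → ∃ C : ℝ, ∀ X : ℝ, 1 ≤ X →
      |(gl2zClassCount fourRealRoots X : ℝ) -
          2 / 27 * (Real.pi ^ 2 / 6) * (volume (posDiscRegion X)).toReal / 4| ≤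
        C * X ^ (3 / 4 + ε))
    (h1 : ∀ ε : ℝ, 0 < ε → ∃ C : ℝ, ∀ X : ℝ, 1 ≤ X →
      |(gl2zClassCount twoRealRoots X : ℝ) -
          2 / 27 * (Real.pi ^ 2 / 6) * (volume (negDiscRegion X)).toReal / 2| ≤
        C * X ^ (3 / 4 + ε))
    (h2 : ∀ ε : ℝ, 0 < ε → ∃ C : ℝ, ∀ X : ℝ, 1 ≤ X →
      |(gl2zClassCount posDefinite X : ℝ) -
          2 / 27 * (Real.pi ^ 2 / 6) * (volume (posDiscRegion X)).toReal / 4| ≤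
        C * X ^ (3 / 4 + ε)) :
    bhargavaShankar_classCount := by
  intro ε hε
  obtain ⟨C₀, hC₀⟩ := h0 ε hε
  obtain ⟨C₁, hC₁⟩ := h1 ε hε
  obtain ⟨C₂, hC₂⟩ := h2 ε hε
  refine ⟨max C₀ (max C₁ (2 * C₂)), fun X hX ↦ ?_⟩
  have hXpos : 0 < X := one_pos.trans_le hX
  have hXe : 0 ≤ X ^ (3 / 4 + ε) := rpow_nonneg hXpos.le _
  have e0 := hC₀ X hX
  have e1 := hC₁ X hX
  have e2 := hC₂ X hX
  rw [volume_posDiscRegion_toReal hXpos] at e0 e2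
  rw [volume_negDiscRegion_toReal hXpos] at e1
  refine ⟨?_, ?_, ?_⟩
  · have : 2 / 27 * (Real.pi ^ 2 / 6) * (8 / 5 * X ^ (5 / 6 : ℝ)) / 4 =
        4 / 135 * (Real.pi ^ 2 / 6) * X ^ (5 / 6 : ℝ) := by ring
    rw [this] at e0
    exact e0.trans (mul_le_mul_of_nonneg_right (le_max_left _ _) hXe)
  · have : 2 / 27 * (Real.pi ^ 2 / 6) * (32 / 5 * X ^ (5 / 6 : ℝ)) / 2 =
        32 / 135 * (Real.pi ^ 2 / 6) * X ^ (5 / 6 : ℝ) := by ring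
    rw [this] at e1
    exact e1.trans (mul_le_mul_of_nonneg_right ((le_max_left _ _).trans (le_max_right _ _)) hXe)
  · have : 2 / 27 * (Real.pi ^ 2 / 6) * (8 / 5 * X ^ (5 / 6 : ℝ)) / 4 =
        4 / 135 * (Real.pi ^ 2 / 6) * X ^ (5 / 6 : ℝ) := by ring
    rw [this] at e2
    rw [gl2zClassCount_noRealRoots X, Nat.cast_mul, Nat.cast_two]
    have : |(2 * (gl2zClassCount posDefinite X : ℝ)) - 8 / 135 * (Real.pi ^ 2 / 6) * X ^ (5 / 6 : ℝ)|
        = 2 * |(gl2zClassCount posDefinite X : ℝ) - 4 / 135 * (Real.pi ^ 2 / 6) * X ^ (5 / 6 : ℝ)| := by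
      rw [show (2 : ℝ) = |(2 : ℝ)| by norm_num, ← abs_mul]
      congr 1; ring
    rw [this]
    calc 2 * |(gl2zClassCount posDefinite X : ℝ) - 4 / 135 * (Real.pi ^ 2 / 6) * X ^ (5 / 6 : ℝ)|
        ≤ 2 * (C₂ * X ^ (3 / 4 + ε)) := by linarith
      _ = (2 * C₂) * X ^ (3 / 4 + ε) := by ring
      _ ≤ max C₀ (max C₁ (2 * C₂)) * X ^ (3 / 4 + ε) :=
          mul_le_mul_of_nonneg_right ((le_max_right _ _).trans (le_max_right _ _)) hXe

end Literature.NumberTheory.EllipticCurves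

end
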